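import Summits.QuantumFields.YangMills.Theorems.FluctuationComparisonRegPrIntLS2BetaTubeGrowthOfHessianPos
import Summits.QuantumFields.YangMills.Theorems.FluctuationComparisonRegPrIntLS2BetaPosCollarLocalRows
import Summits.QuantumFields.YangMills.Theorems.FluctuationComparisonRegPrIntLS2BetaCoeFieldSmoothWindowChart
import Summits.QuantumFields.YangMills.Theorems.FluctuationComparisonRegPrIntLS2BetaChartContLaplaceRows
import Summits.QuantumFields.YangMills.Theorems.FluctuationComparisonRegPrIntLS2BetaTubularChartDockLocal
import HarnessLib

/-!
# S2β · POS∘ — THE TAYLOR HALF (T3): TUBE♭ ⟸ {HESS∘, ISOL∘(δ)} DOCKED ON THE CHART OF RECORD AND THE TUBE OF RECORD — every internal row discharged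

Cell `ym3-torus` (YM ladder rung R3 = continuum `SU(2)` Yang–Mills on the three-torus at fixed lattice data — a RUNG: NOT d = 4, NOT infinite volume,
NOT a mass gap, NOT Clay).  Width seat `ym3-torus-px21` (gen 18); the (T)-chain of px8 g18's pen «Taylor half»: ✓(T1) `…S2BetaGrowthOfHessianPos` (p793318), ✓(T2a)
`…S2BetaPosCollarOfGrowthRow` (p793856), (T2b) `…S2BetaPosCollarCoverOfTubeChart`, (T2c) `…S2BetaTubeGrowthOfHessianPos`, ✓(T2d) `…S2BetaPosCollarLocalRows` (p794300),
(T2e) `…S2BetaCoeFieldSmoothWindowChart`.  Crux `stmt-QuantumFields-20520` (`…Theses.UnitScaleTilt.FluctuationComparisonRegPrIntL`), LINE g18-1 S2β;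
`--kind proof --supports stmt-QuantumFields-20520 --as helper`, count-neutral, DEFINITION-FREE (0 `def`, 0 `instance`, 0 `notation`, 0 `sorry`, default heartbeats).

WHAT.  ★★★★ `tubeGrowth_of_hessian_pos_of_isolated_of_clauses` — (T2c)'s capstone with its five internal rows DISCHARGED from the lane's own letters:
`hcont` ⟸ ✓(T2d) `eventually_continuousAt_descendTo_of_mem_regFibrePr` (`U₀ ∈ regFibrePr`, `2ε₀` an admissible Prop-2 radius); `hΘ` ⟸ (T2c) §0 `nhds_le_map_tubeChart` (tube rows
`e 0 = 1`, `σ 0 = U₀`, `0 ∈ UZ`, `0 ∈ UV`, (F3)); `hΦ0` ⟸ the chart's SELF-RECOGNITION clause (✓`exists_laplaceRows` :144) at `U₀ ∈ closure histGood`; `hΦs` ⟸ (T2e)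
`contDiffAt_coeField_windowChart_of_histGood` (clauses :137 :138+:145 :139 :144 :153); `hfib` ⟸ :153 (live set ∈ 𝓝 U₀) + continuity of `σ` + :137.  HYPOTHESES = the clause texts of
w3-20520 g14's ✓`…ChartContLaplaceRows.exists_laplaceRows` for its `c, T, w` (read at the corner `V`), the tube rows of px21's ✓`exists_tubularHaarChart_pivotAct_local` ∕
✓`exists_tubeRows` for its `e, σ, UZ, UV`, the regime inequalities (`α`, `θBal`, `ε₀`), EXW∘'s rows on `U₀` (`U₀ ∈ regFibrePr ∩ histGood`, `A U₀ = minActionRegPr`) — and the TWO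
analytic letters HESS∘ (`∀ y ≠ 0, 0 < D²(A ∘ c.Φ (V,·) ∘ σ)(0) y y`, print's (142)) and ISOL∘(δ).  So the consumer's docking is `obtain … := exists_laplaceRows …; obtain … :=
exists_tubeRows …; exact tubeGrowth_of_hessian_pos_of_isolated_of_clauses …` — done here once and for all:
★★★★★ `exists_chart_tubeGrowth_of_hessian_pos_of_isolated` — for every `L, b₀, p₀` there is `γ₁ > 0` such that for every member `F` (`F.L = L`), every `γ ≤ γ₁`, every depth `J ≤ K`
(chart dimensions `dZ, dV` of record), every admissible `ε₀`, and every datum `V` with a base point `U₀ ∈ regFibrePr ∩ histGood`, `A U₀ = minActionRegPr` (EXW∘ (2)), THERE ARE the fibred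
chart `Φ := c.Φ (V, ·)` OF RECORD (✓`exists_laplaceRows`) and the tubular transversal `σ` OF RECORD (✓`exists_tubularHaarChart_pivotAct_local`) through `U₀` such that, for every tube radius
`δ`: HESS∘(`Φ ∘ σ`) ∧ ISOL∘(δ) ⟹ TUBE♭(V, U₀) — the regime rows discharged by ✓`exists_gamma_chainRegime`.

HONEST: assembly; HESS∘ ((142); uniformly [Balaban1985BackgroundPropagators] Thm 3.11) and ISOL∘(δ) NOT proved; TUBE-REG∘, GAP♯∘, GAP♭, EXW∘, S2β, crux 20520 NOT proved; no summit statement is proved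
by a helper; finite-volume ∕ conditional; rung R3 = SU(2) YM₃ on T³ — NOT d = 4, NOT infinite volume, NOT a mass gap, NOT Clay; the Yang–Mills mass gap is NOT proved.  Sorry-free, axioms standard.

References: T. Bałaban, CMP **102** (1985) 277–309 [Balaban1985Variational] (Thm 1 (8)–(10) p.279, (142) p.299); CMP **102** (1985) 255–275 [Balaban1985UV3] ((12)–(13) p.259,
(18)–(22) p.260); CMP **109** (1987) 249–301 [Balaban1987RG1] ((0.4) p.253, (2.10) p.267).
-/

set_option autoImplicit false

noncomputable section

namespace Summit.QuantumFields.YangMills.Theorems.FluctuationComparisonRegPrIntLS2BetaTubeGrowthOfHessianPosDock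

open Set Filter Topology Function
open scoped Matrix.Norms.L2Operator
open Literature.MathematicalPhysics.QuantumFieldTheory.Balaban1983to89
open Literature.MathematicalPhysics.QuantumFieldTheory.Balaban1983to89.T3ContinuumYM3Torus
open Literature.MathematicalPhysics.QuantumFieldTheory.Balaban1983to89.T3UnitLawDensityEML (ℰp)
open Literature.MathematicalPhysics.QuantumFieldTheory.Balaban1983to89.T3UnitScaleTilt
open Literature.MathematicalPhysics.QuantumFieldTheory.Balaban1983to89.T3TiltDescent
open Literature.MathematicalPhysics.QuantumFieldTheory.Balaban1983to89.T3ConstrainedMinimiser (fibre)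
open Literature.MathematicalPhysics.QuantumFieldTheory.Balaban1983to89.T3PrintedRegularMinimiser
open Literature.MathematicalPhysics.QuantumFieldTheory.Balaban1983to89.T4Continuum
open Literature.MathematicalPhysics.QuantumFieldTheory.Balaban1983to89.ExpMeanLog (deltaSU)
open Literature.MathematicalPhysics.QuantumFieldTheory.Balaban1983to89.BlockAveraging (Idx)
open scoped Literature.MathematicalPhysics.QuantumFieldTheory.Balaban1983to89.T3OrbitAverage
open Literature.MathematicalPhysics.QuantumFieldTheory.Balaban1983to89.Node00 (coeField)
open Summit.QuantumFields.YangMills.Theorems.FluctuationComparisonRegPrIntLWregChain (iterCentralBond)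
open Summit.QuantumFields.YangMills.Theorems.FluctuationComparisonRegPrIntLWregGlue (WindowChart)
open Summit.QuantumFields.YangMills.Theorems.FluctuationComparisonRegPrIntLS2BetaResidualSubgroup
open Summit.QuantumFields.YangMills.Theorems.FluctuationComparisonRegPrIntLS2BetaTubeGrowthOfHessianPos
open Summit.QuantumFields.YangMills.Theorems.FluctuationComparisonRegPrIntLS2BetaTubeGrowthOfIsolated (gapFlatAt_of_pos_of_isolated_of_closePair)
open Summit.QuantumFields.YangMills.Theorems.FluctuationComparisonRegPrIntLS2BetaPosCollarLocalRows
open Summit.QuantumFields.YangMills.Theorems.FluctuationComparisonRegPrIntLS2BetaCoeFieldSmoothWindowChart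
open Summit.QuantumFields.YangMills.Theorems.FluctuationComparisonRegPrIntLS2BetaChartContLaplaceRows (exists_laplaceRows)
open Summit.QuantumFields.YangMills.Theorems.FluctuationComparisonRegPrIntLS2BetaTubularChartDockLocal (exists_tubularHaarChart_pivotAct_local)
open Summit.QuantumFields.YangMills.Theorems.FluctuationComparisonRegPrIntLS2BetaPeanoSmooth (exists_gamma_chainRegime)

variable (F : T3Family) {J K : ℕ} (hJK : J ≤ K)

/-- ★★★★ **TUBE♭(V,U₀) ⟸ {HESS∘, ISOL∘(δ)} AT THE CHART OF RECORD AND THE TUBE OF RECORD.**  Hypotheses: the regime (`hk`, `α`-rows, `θBal`-rows, `ε₀`-rows); a window chart `c` with the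
clauses of ✓`exists_laplaceRows` read at the corner `V` (`hdesc` :137, `hne` :138, `hΦc` :139, `hself` :144, `hoffT` :145, `hnhds` :153, `hrecog` :154); a tube chart `(e, σ, UZ, UV)` through `U₀`
with the rows of ✓`exists_tubularHaarChart_pivotAct_local` (`he0`, `hσc`, `hσ0`, `hσs`, `h0Z`, `h0V`, (F3) `hF3`); EXW∘'s rows on `U₀` (`hU₀reg`, `hU₀h`, `hmin`); and the two analytic
letters — HESS∘ `hH` and ISOL∘(δ) `hisol`.  Conclusion: the TUBE♭(V,U₀) text of ✓px8 `tubeGrowth_of_pos_of_isolated` VERBATIM.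
[cite: Balaban1985Variational, (142) p.299; Balaban1985UV3, (12)-(13) p.259 and (18)-(22) p.260; Balaban1987RG1, (2.10) p.267] -/
theorem tubeGrowth_of_hessian_pos_of_isolated_of_clauses (hk : K - J ≤ (F.P K).m + (F.P K).K)
    {γ b₀ p₀ ε₀ α : ℝ} (hα24 : α ≤ 1 / 24) (hαδ : α < deltaSU (Fin 2)) (hαL : 157 * α < ((((F.P K).L : ℕ) : ℝ) ^ ((F.P K).d - 1))⁻¹)
    (hθ0 : ∀ i, 0 ≤ θBal F.L γ b₀ p₀ i) (hθα : ∀ i, ((((F.P K).d + 2) * (F.P K).L : ℕ) : ℝ) ^ 2 / 4 * θBal F.L γ b₀ p₀ i ≤ α)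
    (hε₀ : 0 < ε₀) (hr3 : (143 * ((((3 + 4 : ℕ) : ℝ)) ^ 2 / 4) ^ 2) * (2 * ε₀) ≤ 1 / 3)
    (hr2 : 2 * (2 * ε₀) ≤ 2 * deltaSU (Fin 2) / (((3 + 4) * F.L : ℕ) : ℝ) ^ 2)
    -- the chart of record and its clauses at the corner `V`
    {O : Set (GaugeField (F.P J) 0 (Matrix.specialUnitaryGroup (Fin 2) ℂ))}
    (c : WindowChart F hJK (histGood F ℰp (θBal F.L γ b₀ p₀) K J) O)
    (T : PBond (F.P K) (K - J) → GaugeField (F.P K) 0 (Matrix.specialUnitaryGroup (Fin 2) ℂ) → Set (Matrix.specialUnitaryGroup (Fin 2) ℂ))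
    (w : PBond (F.P K) (K - J) → PBond (F.P J) 0)
    (V : GaugeField (F.P J) 0 (Matrix.specialUnitaryGroup (Fin 2) ℂ))
    (hdesc : ∀ z, c.jac (V, z) ≠ 0 → descendTo F ℰp J K hJK (c.Φ (V, z)) = V)
    (hne : ∀ z, c.jac (V, z) ≠ 0 ↔ (∀ c', V (w c') ∈ T c' z) ∧ c.Φ (V, z) ∈ closure (histGood F ℰp (θBal F.L γ b₀ p₀) K J))
    (hΦc : ContinuousOn (fun z => c.Φ (V, z)) {z | c.jac (V, z) ≠ 0})
    (hself : ∀ U, descendTo F ℰp J K hJK U = V → U ∈ closure (histGood F ℰp (θBal F.L γ b₀ p₀) K J) → c.jac (V, U) ≠ 0 ∧ c.Φ (V, U) = U)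
    (hoffT : ∀ z, (∀ c', V (w c') ∈ T c' z) → (∀ b, (∀ c', iterCentralBond (K - J) c' ≠ b) → c.Φ (V, z) b = z b) ∧
      descendTo F ℰp J K hJK (c.Φ (V, z)) = V)
    (hnhds : ∀ U, descendTo F ℰp J K hJK U = V → U ∈ histGood F ℰp (θBal F.L γ b₀ p₀) K J → {z | c.jac (V, z) ≠ 0} ∈ 𝓝 U)
    (hrecog : ∀ z U', U' ∈ closure (histGood F ℰp (θBal F.L γ b₀ p₀) K J) → descendTo F ℰp J K hJK U' = V →
      (∀ b, (∀ c', iterCentralBond (K - J) c' ≠ b) → U' b = z b) → c.jac (V, z) ≠ 0 ∧ c.Φ (V, z) = U')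
    -- the base point: EXW∘'s regular minimising good history
    (U₀ : GaugeField (F.P K) 0 (Matrix.specialUnitaryGroup (Fin 2) ℂ)) (hU₀reg : U₀ ∈ regFibrePr F J K hJK ε₀ V)
    (hU₀h : U₀ ∈ histGood F ℰp (θBal F.L γ b₀ p₀) K J) (hmin : wilsonAction4 U₀ = minActionRegPr F J K hJK ε₀ V)
    -- the tube of record through `U₀`
    {dZ dV : ℕ} (e : EuclideanSpace ℝ (Fin dZ) → ↥(residualSubgroup F hJK) × (PBond (F.P K) (K - J) → Matrix.specialUnitaryGroup (Fin 2) ℂ))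
    (σ : EuclideanSpace ℝ (Fin dV) → GaugeField (F.P K) 0 (Matrix.specialUnitaryGroup (Fin 2) ℂ))
    (he0 : e 0 = 1) (hσc : Continuous σ) (hσ0 : σ 0 = U₀)
    (hσs : ContDiff ℝ ⊤ (fun y : EuclideanSpace ℝ (Fin dV) => fun b : PBond (F.P K) 0 =>
      ((σ y b : Matrix.specialUnitaryGroup (Fin 2) ℂ) : Matrix (Fin 2) (Fin 2) ℂ)))
    {UZ : Set (EuclideanSpace ℝ (Fin dZ))} {UV : Set (EuclideanSpace ℝ (Fin dV))} (h0Z : (0 : EuclideanSpace ℝ (Fin dZ)) ∈ UZ) (h0V : (0 : EuclideanSpace ℝ (Fin dV)) ∈ UV)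
    (hF3 : ∀ p ∈ UZ ×ˢ UV, ∀ s ∈ 𝓝 p,
      (fun p : EuclideanSpace ℝ (Fin dZ) × EuclideanSpace ℝ (Fin dV) => pivotAct F hJK (iterCentralBond (P := F.P K) (K - J)) (e p.1) (σ p.2)) '' s ∈
        𝓝 ((fun p : EuclideanSpace ℝ (Fin dZ) × EuclideanSpace ℝ (Fin dV) => pivotAct F hJK (iterCentralBond (P := F.P K) (K - J)) (e p.1) (σ p.2)) p))
    (δ : ℝ)
    -- the two analytic letters
    (hH : ∀ y, y ≠ 0 → 0 < fderiv ℝ (fderiv ℝ (fun y => wilsonAction4 (c.Φ (V, σ y)))) 0 y y)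
    (hisol : ∀ U ∈ closure (fibre F ℰp J K hJK V ∩ histGood F ℰp (θBal F.L γ b₀ p₀) K J),
        (∃ w : Site (F.P K) 0 → Matrix.specialUnitaryGroup (Fin 2) ℂ,
          (∀ U'' : GaugeField (F.P K) 0 (Matrix.specialUnitaryGroup (Fin 2) ℂ),
              descendTo F ℰp J K hJK (GaugeField.gaugeAct w U'') = descendTo F ℰp J K hJK U'') ∧
            ∀ ℓ : PBond (F.P K) 0, dist1 (U ℓ * ((GaugeField.gaugeAct w U₀) ℓ)⁻¹) ≤ δ) →
        wilsonAction4 U ≤ minActionRegPr F J K hJK ε₀ V →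
        (⨅ w : {w : Site (F.P K) 0 → Matrix.specialUnitaryGroup (Fin 2) ℂ |
            ∀ U : GaugeField (F.P K) 0 (Matrix.specialUnitaryGroup (Fin 2) ℂ),
              descendTo F ℰp J K hJK (GaugeField.gaugeAct w U) = descendTo F ℰp J K hJK U},
          ∑ ℓ : PBond (F.P K) 0,
            dist1 (U ℓ * ((GaugeField.gaugeAct (w : Site (F.P K) 0 → Matrix.specialUnitaryGroup (Fin 2) ℂ) U₀) ℓ)⁻¹) ^ 2) = 0) :
    ∃ μ : ℝ, 0 < μ ∧ ∀ U ∈ fibre F ℰp J K hJK V, U ∈ histGood F ℰp (θBal F.L γ b₀ p₀) K J →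
      (∃ w : Site (F.P K) 0 → Matrix.specialUnitaryGroup (Fin 2) ℂ,
        (∀ U'' : GaugeField (F.P K) 0 (Matrix.specialUnitaryGroup (Fin 2) ℂ),
            descendTo F ℰp J K hJK (GaugeField.gaugeAct w U'') = descendTo F ℰp J K hJK U'') ∧
          ∀ ℓ : PBond (F.P K) 0, dist1 (U ℓ * ((GaugeField.gaugeAct w U₀) ℓ)⁻¹) ≤ δ) →
      μ * ((F.L : ℝ)⁻¹) ^ (2 * (K - J)) *
          (⨅ w : {w : Site (F.P K) 0 → Matrix.specialUnitaryGroup (Fin 2) ℂ |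
              ∀ U : GaugeField (F.P K) 0 (Matrix.specialUnitaryGroup (Fin 2) ℂ),
                descendTo F ℰp J K hJK (GaugeField.gaugeAct w U) = descendTo F ℰp J K hJK U},
            ∑ ℓ : PBond (F.P K) 0,
              dist1 (U ℓ * ((GaugeField.gaugeAct (w : Site (F.P K) 0 → Matrix.specialUnitaryGroup (Fin 2) ℂ) U₀) ℓ)⁻¹) ^ 2)
        ≤ wilsonAction4 U - minActionRegPr F J K hJK ε₀ V := by
  -- EXW∘'s base point descends to `V` and is a closure point of `histGood`
  have hU₀V : descendTo F ℰp J K hJK U₀ = V := ((mem_regFibrePr_iff F).1 hU₀reg).1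
  have hU₀cl : U₀ ∈ closure (histGood F ℰp (θBal F.L γ b₀ p₀) K J) := subset_closure hU₀h
  obtain ⟨hlive, hselfU₀⟩ := hself U₀ hU₀V hU₀cl
  -- live ⇒ off-pivot agreement
  have hoff : ∀ z, c.jac (V, z) ≠ 0 → ∀ b, (∀ c', iterCentralBond (K - J) c' ≠ b) → c.Φ (V, z) b = z b :=
    fun z hz => (hoffT z ((hne z).1 hz).1).1
  -- the five internal rows
  have hcont : ∀ᶠ W in 𝓝 U₀, ContinuousAt (descendTo F ℰp J K hJK) W :=
    eventually_continuousAt_descendTo_of_mem_regFibrePr F hJK hε₀ hr3 hr2 hU₀reg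
  have hΘ := nhds_le_map_tubeChart F hJK e σ he0 hσ0 h0Z h0V hF3
  have hΦ0 : c.Φ (V, σ 0) = U₀ := by rw [hσ0]; exact hselfU₀
  have hΦs : ContDiffAt ℝ 2 (fun y => coeField (c.Φ (V, σ y))) 0 :=
    contDiffAt_coeField_windowChart_of_histGood F hJK hk hα24 hαδ hαL hθ0 hθα c V U₀ hdesc hoff hΦc hlive hselfU₀ (hnhds U₀ hU₀V hU₀h) hU₀V hU₀h
      σ hσc hσ0 hσs 2
  have hfib : ∀ᶠ y in 𝓝 (0 : EuclideanSpace ℝ (Fin dV)), descendTo F ℰp J K hJK (c.Φ (V, σ y)) = V := by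
    have hev : ∀ᶠ y in 𝓝 (0 : EuclideanSpace ℝ (Fin dV)), σ y ∈ {z | c.jac (V, z) ≠ 0} :=
      hσc.continuousAt.preimage_mem_nhds (by rw [hσ0]; exact hnhds U₀ hU₀V hU₀h)
    filter_upwards [hev] with y hy
    exact hdesc (σ y) hy
  exact tubeGrowth_of_hessian_pos_of_isolated F hJK V U₀ δ (fun z => c.Φ (V, z)) (fun z U' h₁ h₂ h₃ => (hrecog z U' h₁ h₂ h₃).2) hcont e σ hΘ hΦ0 hΦs
    hmin hU₀reg hfib hH hisol

/-- ★★★★★ **THE (T)-CHAIN AT THE CHART AND TUBE OF RECORD: ∃ γ₁, ∀ member ∕ depth ∕ datum ∕ EXW∘ base point, ∃ (Φ, σ) OF RECORD, ∀ δ, HESS∘ ∧ ISOL∘(δ) ⟹ TUBE♭(V, U₀).**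
Everything except the two analytic letters is discharged: the regime by ✓`exists_gamma_chainRegime`, the chart clauses by ✓`exists_laplaceRows`, the tube rows by
✓`exists_tubularHaarChart_pivotAct_local`, the internal rows by (T2d)∕(T2e)∕(T2c) §0–§1.  `ε₀` must be an admissible Prop-2 radius (`hr3`, `hr2`, as in ✓`…MinimiserPin`).
[cite: Balaban1985Variational, Thm 1 (8)-(10) p.279 and (142) p.299; Balaban1985UV3, (12)-(13) p.259 and (18)-(22) p.260; Balaban1987RG1, (0.4) p.253 and (2.10) p.267] -/
theorem exists_chart_tubeGrowth_of_hessian_pos_of_isolated (L : ℕ) (b₀ p₀ : ℝ) (hb : 0 < b₀) (hp : 0 < p₀) :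
    ∃ γ₁ : ℝ, 0 < γ₁ ∧ ∀ (F : T3Family) (γ : ℝ), F.L = L → 0 < γ → γ ≤ γ₁ →
      ∀ (J K : ℕ) (hJK : J ≤ K) (hk : K - J ≤ (F.P K).m + (F.P K).K) (dZ dV : ℕ),
        dZ = Module.finrank ℝ (specialUnitaryLogChart (Fin 2)).lie *
          ((Fintype.card (Site (F.P K) 0) - Fintype.card (Site (F.P K) (K - J))) + Fintype.card (PBond (F.P K) (K - J))) →
        dV = Module.finrank ℝ (specialUnitaryLogChart (Fin 2)).lie *
            (Fintype.card (PBond (F.P K) 0) - Fintype.card (PBond (F.P K) (K - J))) -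
          Module.finrank ℝ (specialUnitaryLogChart (Fin 2)).lie * (Fintype.card (Site (F.P K) 0) - Fintype.card (Site (F.P K) (K - J))) →
        ∀ (ε₀ : ℝ), 0 < ε₀ → (143 * ((((3 + 4 : ℕ) : ℝ)) ^ 2 / 4) ^ 2) * (2 * ε₀) ≤ 1 / 3 →
          2 * (2 * ε₀) ≤ 2 * deltaSU (Fin 2) / (((3 + 4) * F.L : ℕ) : ℝ) ^ 2 →
        ∀ (V : GaugeField (F.P J) 0 (Matrix.specialUnitaryGroup (Fin 2) ℂ)) (U₀ : GaugeField (F.P K) 0 (Matrix.specialUnitaryGroup (Fin 2) ℂ)),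
          U₀ ∈ regFibrePr F J K hJK ε₀ V → U₀ ∈ histGood F ℰp (θBal F.L γ b₀ p₀) K J → wilsonAction4 U₀ = minActionRegPr F J K hJK ε₀ V →
          ∃ (Φ : GaugeField (F.P K) 0 (Matrix.specialUnitaryGroup (Fin 2) ℂ) → GaugeField (F.P K) 0 (Matrix.specialUnitaryGroup (Fin 2) ℂ))
            (σ : EuclideanSpace ℝ (Fin dV) → GaugeField (F.P K) 0 (Matrix.specialUnitaryGroup (Fin 2) ℂ)),
            Φ (σ 0) = U₀ ∧ σ 0 = U₀ ∧
            ∀ δ : ℝ,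
              (∀ y, y ≠ 0 → 0 < fderiv ℝ (fderiv ℝ (fun y => wilsonAction4 (Φ (σ y)))) 0 y y) →
              (∀ U ∈ closure (fibre F ℰp J K hJK V ∩ histGood F ℰp (θBal F.L γ b₀ p₀) K J),
                (∃ w : Site (F.P K) 0 → Matrix.specialUnitaryGroup (Fin 2) ℂ,
                  (∀ U'' : GaugeField (F.P K) 0 (Matrix.specialUnitaryGroup (Fin 2) ℂ),
                      descendTo F ℰp J K hJK (GaugeField.gaugeAct w U'') = descendTo F ℰp J K hJK U'') ∧
                    ∀ ℓ : PBond (F.P K) 0, dist1 (U ℓ * ((GaugeField.gaugeAct w U₀) ℓ)⁻¹) ≤ δ) →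
                wilsonAction4 U ≤ minActionRegPr F J K hJK ε₀ V →
                (⨅ w : {w : Site (F.P K) 0 → Matrix.specialUnitaryGroup (Fin 2) ℂ |
                    ∀ U : GaugeField (F.P K) 0 (Matrix.specialUnitaryGroup (Fin 2) ℂ),
                      descendTo F ℰp J K hJK (GaugeField.gaugeAct w U) = descendTo F ℰp J K hJK U},
                  ∑ ℓ : PBond (F.P K) 0,
                    dist1 (U ℓ * ((GaugeField.gaugeAct (w : Site (F.P K) 0 → Matrix.specialUnitaryGroup (Fin 2) ℂ) U₀) ℓ)⁻¹) ^ 2) = 0) →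
              ∃ μ : ℝ, 0 < μ ∧ ∀ U ∈ fibre F ℰp J K hJK V, U ∈ histGood F ℰp (θBal F.L γ b₀ p₀) K J →
                (∃ w : Site (F.P K) 0 → Matrix.specialUnitaryGroup (Fin 2) ℂ,
                  (∀ U'' : GaugeField (F.P K) 0 (Matrix.specialUnitaryGroup (Fin 2) ℂ),
                      descendTo F ℰp J K hJK (GaugeField.gaugeAct w U'') = descendTo F ℰp J K hJK U'') ∧
                    ∀ ℓ : PBond (F.P K) 0, dist1 (U ℓ * ((GaugeField.gaugeAct w U₀) ℓ)⁻¹) ≤ δ) →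
                μ * ((F.L : ℝ)⁻¹) ^ (2 * (K - J)) *
                    (⨅ w : {w : Site (F.P K) 0 → Matrix.specialUnitaryGroup (Fin 2) ℂ |
                        ∀ U : GaugeField (F.P K) 0 (Matrix.specialUnitaryGroup (Fin 2) ℂ),
                          descendTo F ℰp J K hJK (GaugeField.gaugeAct w U) = descendTo F ℰp J K hJK U},
                      ∑ ℓ : PBond (F.P K) 0,
                        dist1 (U ℓ * ((GaugeField.gaugeAct (w : Site (F.P K) 0 → Matrix.specialUnitaryGroup (Fin 2) ℂ) U₀) ℓ)⁻¹) ^ 2)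
                  ≤ wilsonAction4 U - minActionRegPr F J K hJK ε₀ V := by
  classical
  obtain ⟨γ₁, hγ₁, hmain⟩ := exists_laplaceRows L b₀ p₀ hb hp
  obtain ⟨α, γ₂, hα0, hα24, hαδ, hγ₂, hreg⟩ := exists_gamma_chainRegime L b₀ p₀ hb hp
  refine ⟨min γ₁ γ₂, lt_min hγ₁ hγ₂, ?_⟩
  intro F γ hFL hγ hγle J K hJK hk dZ dV hdZ hdV ε₀ hε₀ hr3 hr2 V U₀ hU₀reg hU₀h hmin
  obtain ⟨c, T, w, h137, h138, h139, -, -, -, h144, h145, -, -, h153, h154, -⟩ := hmain F γ hFL hγ (hγle.trans (min_le_left _ _)) J K hJK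
  obtain ⟨hαL, hθ0, hθα⟩ := hreg F γ hFL hγ (hγle.trans (min_le_right _ _)) K
  obtain ⟨e, σ, eV, UZ, UV, jZ, jV, ρ, -, he1, -, hσc, hσ0, hσs, -, -, -, -, -, -, -, h0Z, h0V, -, hF3, -⟩ :=
    exists_tubularHaarChart_pivotAct_local F hJK hk dZ dV hdZ hdV U₀
  have hU₀V : descendTo F ℰp J K hJK U₀ = V := ((mem_regFibrePr_iff F).1 hU₀reg).1
  have hΦ0 : c.Φ (V, σ 0) = U₀ := by rw [hσ0]; exact (h144 V U₀ hU₀V (subset_closure hU₀h)).2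
  refine ⟨fun z => c.Φ (V, z), σ, hΦ0, hσ0, fun δ hH hisol => ?_⟩
  exact tubeGrowth_of_hessian_pos_of_isolated_of_clauses F hJK hk hα24 hαδ hαL hθ0 hθα hε₀ hr3 hr2 c T w V (h137 V) (h138 V) (h139 V).1 (h144 V)
    (h145 V) (h153 V) (h154 V) U₀ hU₀reg hU₀h hmin e σ he1 hσc hσ0 hσs h0Z h0V hF3 δ hH hisol

/-- ★★★★ **POS∘ ⟸ HESS∘ AT THE CHART OF RECORD AND THE TUBE OF RECORD** (px8's `hpos` VERBATIM; same hypotheses as `tubeGrowth_of_hessian_pos_of_isolated_of_clauses` minus ISOL∘).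
[cite: Balaban1985Variational, (142) p.299; Balaban1985UV3, (18)-(22) p.260; Balaban1987RG1, (2.10) p.267] -/
theorem posCollar_of_hessian_pos_of_clauses (hk : K - J ≤ (F.P K).m + (F.P K).K)
    {γ b₀ p₀ ε₀ α : ℝ} (hα24 : α ≤ 1 / 24) (hαδ : α < deltaSU (Fin 2)) (hαL : 157 * α < ((((F.P K).L : ℕ) : ℝ) ^ ((F.P K).d - 1))⁻¹)
    (hθ0 : ∀ i, 0 ≤ θBal F.L γ b₀ p₀ i) (hθα : ∀ i, ((((F.P K).d + 2) * (F.P K).L : ℕ) : ℝ) ^ 2 / 4 * θBal F.L γ b₀ p₀ i ≤ α)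
    (hε₀ : 0 < ε₀) (hr3 : (143 * ((((3 + 4 : ℕ) : ℝ)) ^ 2 / 4) ^ 2) * (2 * ε₀) ≤ 1 / 3)
    (hr2 : 2 * (2 * ε₀) ≤ 2 * deltaSU (Fin 2) / (((3 + 4) * F.L : ℕ) : ℝ) ^ 2)
    {O : Set (GaugeField (F.P J) 0 (Matrix.specialUnitaryGroup (Fin 2) ℂ))}
    (c : WindowChart F hJK (histGood F ℰp (θBal F.L γ b₀ p₀) K J) O)
    (T : PBond (F.P K) (K - J) → GaugeField (F.P K) 0 (Matrix.specialUnitaryGroup (Fin 2) ℂ) → Set (Matrix.specialUnitaryGroup (Fin 2) ℂ))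
    (w : PBond (F.P K) (K - J) → PBond (F.P J) 0)
    (V : GaugeField (F.P J) 0 (Matrix.specialUnitaryGroup (Fin 2) ℂ))
    (hdesc : ∀ z, c.jac (V, z) ≠ 0 → descendTo F ℰp J K hJK (c.Φ (V, z)) = V)
    (hne : ∀ z, c.jac (V, z) ≠ 0 ↔ (∀ c', V (w c') ∈ T c' z) ∧ c.Φ (V, z) ∈ closure (histGood F ℰp (θBal F.L γ b₀ p₀) K J))
    (hΦc : ContinuousOn (fun z => c.Φ (V, z)) {z | c.jac (V, z) ≠ 0})
    (hself : ∀ U, descendTo F ℰp J K hJK U = V → U ∈ closure (histGood F ℰp (θBal F.L γ b₀ p₀) K J) → c.jac (V, U) ≠ 0 ∧ c.Φ (V, U) = U)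
    (hoffT : ∀ z, (∀ c', V (w c') ∈ T c' z) → (∀ b, (∀ c', iterCentralBond (K - J) c' ≠ b) → c.Φ (V, z) b = z b) ∧
      descendTo F ℰp J K hJK (c.Φ (V, z)) = V)
    (hnhds : ∀ U, descendTo F ℰp J K hJK U = V → U ∈ histGood F ℰp (θBal F.L γ b₀ p₀) K J → {z | c.jac (V, z) ≠ 0} ∈ 𝓝 U)
    (hrecog : ∀ z U', U' ∈ closure (histGood F ℰp (θBal F.L γ b₀ p₀) K J) → descendTo F ℰp J K hJK U' = V →
      (∀ b, (∀ c', iterCentralBond (K - J) c' ≠ b) → U' b = z b) → c.jac (V, z) ≠ 0 ∧ c.Φ (V, z) = U')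
    (U₀ : GaugeField (F.P K) 0 (Matrix.specialUnitaryGroup (Fin 2) ℂ)) (hU₀reg : U₀ ∈ regFibrePr F J K hJK ε₀ V)
    (hU₀h : U₀ ∈ histGood F ℰp (θBal F.L γ b₀ p₀) K J) (hmin : wilsonAction4 U₀ = minActionRegPr F J K hJK ε₀ V)
    {dZ dV : ℕ} (e : EuclideanSpace ℝ (Fin dZ) → ↥(residualSubgroup F hJK) × (PBond (F.P K) (K - J) → Matrix.specialUnitaryGroup (Fin 2) ℂ))
    (σ : EuclideanSpace ℝ (Fin dV) → GaugeField (F.P K) 0 (Matrix.specialUnitaryGroup (Fin 2) ℂ))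
    (he0 : e 0 = 1) (hσc : Continuous σ) (hσ0 : σ 0 = U₀)
    (hσs : ContDiff ℝ ⊤ (fun y : EuclideanSpace ℝ (Fin dV) => fun b : PBond (F.P K) 0 =>
      ((σ y b : Matrix.specialUnitaryGroup (Fin 2) ℂ) : Matrix (Fin 2) (Fin 2) ℂ)))
    {UZ : Set (EuclideanSpace ℝ (Fin dZ))} {UV : Set (EuclideanSpace ℝ (Fin dV))} (h0Z : (0 : EuclideanSpace ℝ (Fin dZ)) ∈ UZ) (h0V : (0 : EuclideanSpace ℝ (Fin dV)) ∈ UV)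
    (hF3 : ∀ p ∈ UZ ×ˢ UV, ∀ s ∈ 𝓝 p,
      (fun p : EuclideanSpace ℝ (Fin dZ) × EuclideanSpace ℝ (Fin dV) => pivotAct F hJK (iterCentralBond (P := F.P K) (K - J)) (e p.1) (σ p.2)) '' s ∈
        𝓝 ((fun p : EuclideanSpace ℝ (Fin dZ) × EuclideanSpace ℝ (Fin dV) => pivotAct F hJK (iterCentralBond (P := F.P K) (K - J)) (e p.1) (σ p.2)) p))
    (δ : ℝ)
    (hH : ∀ y, y ≠ 0 → 0 < fderiv ℝ (fderiv ℝ (fun y => wilsonAction4 (c.Φ (V, σ y)))) 0 y y) :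
    ∃ r c₀ : ℝ, 0 < r ∧ 0 < c₀ ∧
      ∀ U ∈ closure (fibre F ℰp J K hJK V ∩ histGood F ℰp (θBal F.L γ b₀ p₀) K J),
        (∃ w : Site (F.P K) 0 → Matrix.specialUnitaryGroup (Fin 2) ℂ,
          (∀ U'' : GaugeField (F.P K) 0 (Matrix.specialUnitaryGroup (Fin 2) ℂ),
              descendTo F ℰp J K hJK (GaugeField.gaugeAct w U'') = descendTo F ℰp J K hJK U'') ∧
            ∀ ℓ : PBond (F.P K) 0, dist1 (U ℓ * ((GaugeField.gaugeAct w U₀) ℓ)⁻¹) ≤ δ) →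
        (⨅ w : {w : Site (F.P K) 0 → Matrix.specialUnitaryGroup (Fin 2) ℂ |
            ∀ U : GaugeField (F.P K) 0 (Matrix.specialUnitaryGroup (Fin 2) ℂ),
              descendTo F ℰp J K hJK (GaugeField.gaugeAct w U) = descendTo F ℰp J K hJK U},
          ∑ ℓ : PBond (F.P K) 0,
            dist1 (U ℓ * ((GaugeField.gaugeAct (w : Site (F.P K) 0 → Matrix.specialUnitaryGroup (Fin 2) ℂ) U₀) ℓ)⁻¹) ^ 2) ≤ r →
        c₀ * (⨅ w : {w : Site (F.P K) 0 → Matrix.specialUnitaryGroup (Fin 2) ℂ |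
            ∀ U : GaugeField (F.P K) 0 (Matrix.specialUnitaryGroup (Fin 2) ℂ),
              descendTo F ℰp J K hJK (GaugeField.gaugeAct w U) = descendTo F ℰp J K hJK U},
          ∑ ℓ : PBond (F.P K) 0,
            dist1 (U ℓ * ((GaugeField.gaugeAct (w : Site (F.P K) 0 → Matrix.specialUnitaryGroup (Fin 2) ℂ) U₀) ℓ)⁻¹) ^ 2)
          ≤ wilsonAction4 U - minActionRegPr F J K hJK ε₀ V := by
  have hU₀V : descendTo F ℰp J K hJK U₀ = V := ((mem_regFibrePr_iff F).1 hU₀reg).1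
  have hU₀cl : U₀ ∈ closure (histGood F ℰp (θBal F.L γ b₀ p₀) K J) := subset_closure hU₀h
  obtain ⟨hlive, hselfU₀⟩ := hself U₀ hU₀V hU₀cl
  have hoff : ∀ z, c.jac (V, z) ≠ 0 → ∀ b, (∀ c', iterCentralBond (K - J) c' ≠ b) → c.Φ (V, z) b = z b :=
    fun z hz => (hoffT z ((hne z).1 hz).1).1
  have hcont : ∀ᶠ W in 𝓝 U₀, ContinuousAt (descendTo F ℰp J K hJK) W :=
    eventually_continuousAt_descendTo_of_mem_regFibrePr F hJK hε₀ hr3 hr2 hU₀reg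
  have hΘ := nhds_le_map_tubeChart F hJK e σ he0 hσ0 h0Z h0V hF3
  have hΦ0 : c.Φ (V, σ 0) = U₀ := by rw [hσ0]; exact hselfU₀
  have hΦs : ContDiffAt ℝ 2 (fun y => coeField (c.Φ (V, σ y))) 0 :=
    contDiffAt_coeField_windowChart_of_histGood F hJK hk hα24 hαδ hαL hθ0 hθα c V U₀ hdesc hoff hΦc hlive hselfU₀ (hnhds U₀ hU₀V hU₀h) hU₀V hU₀h
      σ hσc hσ0 hσs 2
  have hfib : ∀ᶠ y in 𝓝 (0 : EuclideanSpace ℝ (Fin dV)), descendTo F ℰp J K hJK (c.Φ (V, σ y)) = V := by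
    have hev : ∀ᶠ y in 𝓝 (0 : EuclideanSpace ℝ (Fin dV)), σ y ∈ {z | c.jac (V, z) ≠ 0} :=
      hσc.continuousAt.preimage_mem_nhds (by rw [hσ0]; exact hnhds U₀ hU₀V hU₀h)
    filter_upwards [hev] with y hy
    exact hdesc (σ y) hy
  exact posCollar_of_hessian_pos F hJK V U₀ δ (fun z => c.Φ (V, z)) (fun z U' h₁ h₂ h₃ => (hrecog z U' h₁ h₂ h₃).2) hcont e σ hΘ hΦ0 hΦs
    hmin hU₀reg hfib hH

/-- ★★★★★ **GAP♭(V,U₀) ⟸ {HESS∘, ISOL∘(δ)} AT THE CHART AND TUBE OF RECORD, FOR `γ ≤ γ₁(δ)`** — ✓px8 `gapFlatAt_of_pos_of_isolated_of_closePair` (CLOSE-PAIR∘ ✓`closePair_holds` puts every good history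
of the fibre in the `δ`-tube) with its POS∘ letter discharged from HESS∘ by `posCollar_of_hessian_pos_of_clauses`; the chart∕tube of record and the regime obtained inside.  For every
`L, b₀, p₀` and every tube radius `δ > 0`: `∃ γ₁ > 0`, for every member, `γ ≤ γ₁`, depth, admissible `ε₀`, datum `V` and EXW∘ base point `U₀`, THERE ARE `(Φ, σ)` of record through `U₀` with
HESS∘(`Φ ∘ σ`) ∧ ISOL∘(δ) ⟹ GAP♭(V,U₀) (px17's text: `∃ μ > 0`, `μ·L^{−2(K−J)}·D U ≤ A U − min` for EVERY good history `U` of the fibre).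
[cite: Balaban1985Variational, Thm 1 (8)-(10) p.279 and (142) p.299; Balaban1985UV3, (12)-(13) p.259 and (18)-(22) p.260; Balaban1987RG1, (2.10) p.267] -/
theorem exists_chart_gapFlat_of_hessian_pos_of_isolated (L : ℕ) (b₀ p₀ : ℝ) (hb : 0 < b₀) (hp : 0 < p₀) (δ : ℝ) (hδ : 0 < δ) :
    ∃ γ₁ : ℝ, 0 < γ₁ ∧ ∀ (F : T3Family) (γ : ℝ), F.L = L → 0 < γ → γ ≤ γ₁ →
      ∀ (J K : ℕ) (hJK : J ≤ K) (hk : K - J ≤ (F.P K).m + (F.P K).K) (dZ dV : ℕ),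
        dZ = Module.finrank ℝ (specialUnitaryLogChart (Fin 2)).lie *
          ((Fintype.card (Site (F.P K) 0) - Fintype.card (Site (F.P K) (K - J))) + Fintype.card (PBond (F.P K) (K - J))) →
        dV = Module.finrank ℝ (specialUnitaryLogChart (Fin 2)).lie *
            (Fintype.card (PBond (F.P K) 0) - Fintype.card (PBond (F.P K) (K - J))) -
          Module.finrank ℝ (specialUnitaryLogChart (Fin 2)).lie * (Fintype.card (Site (F.P K) 0) - Fintype.card (Site (F.P K) (K - J))) →
        ∀ (ε₀ : ℝ), 0 < ε₀ → (143 * ((((3 + 4 : ℕ) : ℝ)) ^ 2 / 4) ^ 2) * (2 * ε₀) ≤ 1 / 3 →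
          2 * (2 * ε₀) ≤ 2 * deltaSU (Fin 2) / (((3 + 4) * F.L : ℕ) : ℝ) ^ 2 →
        ∀ (V : GaugeField (F.P J) 0 (Matrix.specialUnitaryGroup (Fin 2) ℂ)) (U₀ : GaugeField (F.P K) 0 (Matrix.specialUnitaryGroup (Fin 2) ℂ)),
          U₀ ∈ regFibrePr F J K hJK ε₀ V → U₀ ∈ histGood F ℰp (θBal F.L γ b₀ p₀) K J → wilsonAction4 U₀ = minActionRegPr F J K hJK ε₀ V →
          ∃ (Φ : GaugeField (F.P K) 0 (Matrix.specialUnitaryGroup (Fin 2) ℂ) → GaugeField (F.P K) 0 (Matrix.specialUnitaryGroup (Fin 2) ℂ))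
            (σ : EuclideanSpace ℝ (Fin dV) → GaugeField (F.P K) 0 (Matrix.specialUnitaryGroup (Fin 2) ℂ)),
            Φ (σ 0) = U₀ ∧ σ 0 = U₀ ∧
              ((∀ y, y ≠ 0 → 0 < fderiv ℝ (fderiv ℝ (fun y => wilsonAction4 (Φ (σ y)))) 0 y y) →
              (∀ U ∈ closure (fibre F ℰp J K hJK V ∩ histGood F ℰp (θBal F.L γ b₀ p₀) K J),
                (∃ w : Site (F.P K) 0 → Matrix.specialUnitaryGroup (Fin 2) ℂ,
                  (∀ U'' : GaugeField (F.P K) 0 (Matrix.specialUnitaryGroup (Fin 2) ℂ),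
                      descendTo F ℰp J K hJK (GaugeField.gaugeAct w U'') = descendTo F ℰp J K hJK U'') ∧
                    ∀ ℓ : PBond (F.P K) 0, dist1 (U ℓ * ((GaugeField.gaugeAct w U₀) ℓ)⁻¹) ≤ δ) →
                wilsonAction4 U ≤ minActionRegPr F J K hJK ε₀ V →
                (⨅ w : {w : Site (F.P K) 0 → Matrix.specialUnitaryGroup (Fin 2) ℂ |
                    ∀ U : GaugeField (F.P K) 0 (Matrix.specialUnitaryGroup (Fin 2) ℂ),
                      descendTo F ℰp J K hJK (GaugeField.gaugeAct w U) = descendTo F ℰp J K hJK U},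
                  ∑ ℓ : PBond (F.P K) 0,
                    dist1 (U ℓ * ((GaugeField.gaugeAct (w : Site (F.P K) 0 → Matrix.specialUnitaryGroup (Fin 2) ℂ) U₀) ℓ)⁻¹) ^ 2) = 0) →
              ∃ μ : ℝ, 0 < μ ∧ ∀ U ∈ fibre F ℰp J K hJK V, U ∈ histGood F ℰp (θBal F.L γ b₀ p₀) K J →
                μ * ((F.L : ℝ)⁻¹) ^ (2 * (K - J)) *
                    (⨅ w : {w : Site (F.P K) 0 → Matrix.specialUnitaryGroup (Fin 2) ℂ |
                        ∀ U : GaugeField (F.P K) 0 (Matrix.specialUnitaryGroup (Fin 2) ℂ),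
                          descendTo F ℰp J K hJK (GaugeField.gaugeAct w U) = descendTo F ℰp J K hJK U},
                      ∑ ℓ : PBond (F.P K) 0,
                        dist1 (U ℓ * ((GaugeField.gaugeAct (w : Site (F.P K) 0 → Matrix.specialUnitaryGroup (Fin 2) ℂ) U₀) ℓ)⁻¹) ^ 2)
                  ≤ wilsonAction4 U - minActionRegPr F J K hJK ε₀ V) := by
  classical
  obtain ⟨γ₁, hγ₁, hmain⟩ := exists_laplaceRows L b₀ p₀ hb hp
  obtain ⟨α, γ₂, hα0, hα24, hαδ, hγ₂, hreg⟩ := exists_gamma_chainRegime L b₀ p₀ hb hp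
  obtain ⟨γ₃, hγ₃, hCP⟩ := gapFlatAt_of_pos_of_isolated_of_closePair L b₀ p₀ hb hp δ hδ
  refine ⟨min (min γ₁ γ₂) γ₃, lt_min (lt_min hγ₁ hγ₂) hγ₃, ?_⟩
  intro F γ hFL hγ hγle J K hJK hk dZ dV hdZ hdV ε₀ hε₀ hr3 hr2 V U₀ hU₀reg hU₀h hmin
  have hγ1 : γ ≤ γ₁ := hγle.trans ((min_le_left _ _).trans (min_le_left _ _))
  have hγ2 : γ ≤ γ₂ := hγle.trans ((min_le_left _ _).trans (min_le_right _ _))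
  have hγ3 : γ ≤ γ₃ := hγle.trans (min_le_right _ _)
  obtain ⟨c, T, w, h137, h138, h139, -, -, -, h144, h145, -, -, h153, h154, -⟩ := hmain F γ hFL hγ hγ1 J K hJK
  obtain ⟨hαL, hθ0, hθα⟩ := hreg F γ hFL hγ hγ2 K
  obtain ⟨e, σ, eV, UZ, UV, jZ, jV, ρ, -, he1, -, hσc, hσ0, hσs, -, -, -, -, -, -, -, h0Z, h0V, -, hF3, -⟩ :=
    exists_tubularHaarChart_pivotAct_local F hJK hk dZ dV hdZ hdV U₀
  have hU₀V : descendTo F ℰp J K hJK U₀ = V := ((mem_regFibrePr_iff F).1 hU₀reg).1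
  have hΦ0 : c.Φ (V, σ 0) = U₀ := by rw [hσ0]; exact (h144 V U₀ hU₀V (subset_closure hU₀h)).2
  refine ⟨fun z => c.Φ (V, z), σ, hΦ0, hσ0, fun hH hisol => ?_⟩
  exact hCP F γ hFL hγ hγ3 J K hJK ε₀ V U₀ hU₀V hU₀h
    (posCollar_of_hessian_pos_of_clauses F hJK hk hα24 hαδ hαL hθ0 hθα hε₀ hr3 hr2 c T w V (h137 V) (h138 V) (h139 V).1 (h144 V) (h145 V) (h153 V) (h154 V)
      U₀ hU₀reg hU₀h hmin e σ he1 hσc hσ0 hσs h0Z h0V hF3 δ hH) hisol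

end Summit.QuantumFields.YangMills.Theorems.FluctuationComparisonRegPrIntLS2BetaTubeGrowthOfHessianPosDock

end
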